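import Mathlib
import Summits.MatrixMultiplication.MatrixMultiplication.Theorems.AbelianSTPPSieveVP
import Summits.MatrixMultiplication.MatrixMultiplication.Theorems.AbelianSTPPCensusVPSharp338

/-!
# Uniform families are invisible to the vP shape census (general form of the method ceiling)

For the uniform shape list `(s,s,s) × k` the whole rule set vP = vM ∧ U11-G ∧ U11-P reduces to two packing inequalities:
if `1 ≤ s`, `s³ + k·s² ≤ M` and `3·k·s² ≤ M` then the list is `SieveAdmissibleVP M` (`uniform_sieveAdmissibleVP`) — the Grynkiewicz and
Pollard floors are swallowed by the packing slack, and the U14 tightness clauses are met by the divisor `d = s²`.  It beats `τ = 5/2` as soon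
as `k·q > M` for some `q ≥ 0` with `q⁶ ≤ (s³)⁵`, i.e. essentially `k·s^{5/2} > M` (`uniform_beats`).  Hence (`uniform_alive`) every order `M`
with such `(s,k,q)`, `k ≥ 2`, carries a vP-admissible beating list: no census statement of the shape of crux `ShapeExclusionVP337` can hold at
`M`.  `VPCensusFailsAbove6144.lean` is the instance `s = 16`, `k = ⌊M/768⌋`, `q = 1024` (all `M ≥ 6144`); W2's scan (cell mm-stpp) finds such
triples for every `M ≥ 1322`.  Cell mm-stpp, planner gen 7; a METHOD-barrier fact, not a statement about STPPs or ω.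
-/

set_option linter.dupNamespace false

namespace Summit.MatrixMultiplication.MatrixMultiplication.Theorems

namespace AbelianSTPPCensusVP

open Finset

/-- the uniform size list `(s, …, s)` on `k` members -/
def cu (s k : ℕ) : Fin k → ℕ := fun _ => s

section sums
variable (s k : ℕ)

/-- every member of the uniform list has size `s` -/
@[simp] theorem cu_apply (i : Fin k) : cu s k i = s := rfl

/-- `pAB` of the uniform family is `k·s²` -/
theorem pAB_cu : pAB (cu s k) (cu s k) (cu s k) = k * (s * s) := by
  simp [pAB, cu, sum_const, card_univ, Fintype.card_fin]

/-- `pBC` of the uniform family is `k·s²` -/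
theorem pBC_cu : pBC (cu s k) (cu s k) (cu s k) = k * (s * s) := by
  simp [pBC, cu, sum_const, card_univ, Fintype.card_fin]

/-- `pCA` of the uniform family is `k·s²` -/
theorem pCA_cu : pCA (cu s k) (cu s k) (cu s k) = k * (s * s) := by
  simp [pCA, cu, sum_const, card_univ, Fintype.card_fin]

/-- `ubB` of the uniform family: `k·s²·min(t,s) + t·(M − k s²)` -/
theorem ubB_cu (M t : ℕ) :
    ubB M (cu s k) (cu s k) (cu s k) t = k * (s * s * min t s) + t * (M - k * (s * s)) := by
  simp [ubB, pCA_cu, cu, sum_const, card_univ, Fintype.card_fin]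

/-- every member of the uniform family has volume `s³` -/
theorem shapeVol_cu (i : Fin k) : shapeVol (cu s k) (cu s k) (cu s k) i = s * s * s := by
  simp [shapeVol, cu]

/-- the U14 sum of the uniform family at any member is `s³ + (k − 1)·s²` -/
theorem u14Sum_cu (i : Fin k) :
    u14Sum (shapeVol (cu s k) (cu s k) (cu s k)) (cu s k) (cu s k) i = s * s * s + (k - 1) * (s * s) := by
  simp [u14Sum, shapeVol_cu, cu, sum_const, card_erase_of_mem (mem_univ i), card_univ, Fintype.card_fin]

end sums

/-- U11-G (form B) for a uniform family: swallowed by the packing slack `3ks² ≤ M`. -/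
theorem uniform_u11GFormB {M s k : ℕ} (hP : 3 * k * s ^ 2 ≤ M) : U11GFormB M (cu s k) (cu s k) (cu s k) := by
  intro t h2 _ _ _
  simp only [pAB_cu, pBC_cu, ubB_cu]
  have hP' : 3 * (k * (s * s)) ≤ M := by simpa [sq, mul_assoc] using hP
  have hsub : t * (M - k * (s * s)) + t * (k * (s * s)) = t * M := by
    rw [← mul_add]; congr 1; omega
  have h1 : t * (3 * (k * (s * s))) ≤ t * M := Nat.mul_le_mul_left t hP'
  have h0 : 0 ≤ k * (s * s * min t s) := Nat.zero_le _
  have htt : 1 ≤ t * t := Nat.one_le_iff_ne_zero.mpr (by positivity)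
  refine ⟨fun ht => ?_, fun ht => ?_⟩
  · subst ht; nlinarith [hsub, h1, h0]
  · have hsq : 2 * t ^ 2 = 2 * (t * t) := by ring
    rw [hsq]; nlinarith [hsub, h1, h0, htt]

/-- U11-P (form B) for a uniform family: swallowed by the packing slack `3ks² ≤ M`. -/
theorem uniform_u11PFormB {M s k : ℕ} (hP : 3 * k * s ^ 2 ≤ M) : U11PFormB M (cu s k) (cu s k) (cu s k) := by
  intro t _ _ _
  simp only [pAB_cu, pBC_cu, ubB_cu]
  have hP' : 3 * (k * (s * s)) ≤ M := by simpa [sq, mul_assoc] using hP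
  have hsub : t * (M - k * (s * s)) + t * (k * (s * s)) = t * M := by
    rw [← mul_add]; congr 1; omega
  have h1 : t * (3 * (k * (s * s))) ≤ t * M := Nat.mul_le_mul_left t hP'
  have hmin : t * min M (k * (s * s) + k * (s * s) - t) ≤ t * (2 * (k * (s * s))) :=
    Nat.mul_le_mul_left t ((min_le_right _ _).trans (by omega))
  have h0 : 0 ≤ k * (s * s * min t s) := Nat.zero_le _
  nlinarith [hmin, h1, h0, hsub]

/-- A uniform family is vM-admissible under the two packing inequalities. -/
theorem uniform_sieveAdmissible {M s k : ℕ} (hs : 1 ≤ s) (hV : s ^ 3 + k * s ^ 2 ≤ M) (hP : 3 * k * s ^ 2 ≤ M) :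
    SieveAdmissible M (cu s k) (cu s k) (cu s k) := by
  have hV' : s * s * s + k * (s * s) ≤ M := by simpa [sq, pow_succ, mul_assoc, mul_comm, mul_left_comm] using hV
  have hP' : 3 * (k * (s * s)) ≤ M := by simpa [sq, mul_assoc] using hP
  have hss : s ≤ s * s := by nlinarith
  -- with a member present, `k ≥ 1`, so `s² ≤ k s²`
  have hk1 : ∀ _i : Fin k, s * s ≤ k * (s * s) := fun i => by
    have : 1 ≤ k := Nat.one_le_of_lt i.pos
    nlinarith
  -- with two distinct members present, `k ≥ 2`
  have hk2 : ∀ i j : Fin k, i ≠ j → 2 * (s * s) ≤ k * (s * s) := fun i j hij => by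
    have : 2 ≤ k := by
      by_contra h
      have hk : k ≤ 1 := by omega
      exact hij (Fin.ext (by have := i.isLt; have := j.isLt; omega))
    nlinarith
  -- the tightness witness `d = s²`
  have hd : ∀ l : Fin k, u14Sum (shapeVol (cu s k) (cu s k) (cu s k)) (cu s k) (cu s k) l = M →
      HasLargeCommonDivisor (s * s * s) M (s * s) := by
    intro l h
    rw [u14Sum_cu] at h
    refine ⟨s * s, le_rfl, ⟨s, by ring⟩, ⟨s + (k - 1), ?_⟩⟩
    rw [← h]; ring
  have hd' : ∀ l : Fin k, u14Sum (shapeVol (cu s k) (cu s k) (cu s k)) (cu s k) (cu s k) l = M →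
      HasLargeCommonDivisor (s * s * s) M s := fun l h => by
    obtain ⟨d, hd1, hd2, hd3⟩ := hd l h
    exact ⟨d, hss.trans hd1, hd2, hd3⟩
  have hle : ∀ l : Fin k, u14Sum (shapeVol (cu s k) (cu s k) (cu s k)) (cu s k) (cu s k) l ≤ M := fun l => by
    rw [u14Sum_cu]
    have : (k - 1) * (s * s) ≤ k * (s * s) := Nat.mul_le_mul_right _ (Nat.sub_le k 1)
    omega
  dsimp only [SieveAdmissible]
  refine ⟨fun i => ?_, fun i => ?_, ?_, fun i => ?_, fun i j hij => ?_, fun l => ?_, fun l => ?_⟩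
  · simp only [cu_apply, shapeVol_cu]
    have := hk1 i
    exact ⟨hs, hs, hs, by omega⟩
  · simp only [cu_apply]
    have := hk1 i
    have h2 : s * (s + s - 1) ≤ 3 * (s * s) := by
      have : s + s - 1 ≤ 3 * s := by omega
      calc s * (s + s - 1) ≤ s * (3 * s) := Nat.mul_le_mul_left s this
        _ = 3 * (s * s) := by ring
    have h3 : 3 * (s * s) ≤ 3 * (k * (s * s)) := by omega
    refine ⟨?_, ?_, ?_⟩ <;> omega
  · simp only [cu_apply, sum_const, card_univ, Fintype.card_fin, smul_eq_mul]
    refine ⟨?_, ?_, ?_⟩ <;> omega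
  · simp only [cu_apply, sum_const, card_univ, Fintype.card_fin, smul_eq_mul]
    have := hk1 i
    have h2 : k * (s * (s + s)) = 2 * (k * (s * s)) := by ring
    refine ⟨?_, ?_, ?_⟩ <;> omega
  · simp only [cu_apply, shapeVol_cu]
    have := hk2 i j hij
    refine ⟨?_, ?_, ?_, ?_, ?_, ?_⟩ <;> nlinarith
  · simp only [shapeVol_cu, cu_apply] at hd' hle ⊢
    exact ⟨hle l, hd' l, hle l, hd' l, hle l, hd' l⟩
  · simp only [shapeVol_cu, cu_apply] at hd ⊢
    exact ⟨fun h _ => hd l h, fun h _ => hd l h, fun h _ => hd l h⟩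

/-- … and vP-admissible: U11-G and U11-P (all three forms coincide for a uniform family) hold by packing slack. -/
theorem uniform_sieveAdmissibleVP {M s k : ℕ} (hs : 1 ≤ s) (hV : s ^ 3 + k * s ^ 2 ≤ M) (hP : 3 * k * s ^ 2 ≤ M) :
    SieveAdmissibleVP M (cu s k) (cu s k) (cu s k) :=
  ⟨uniform_sieveAdmissible hs hV hP, ⟨uniform_u11GFormB hP, uniform_u11GFormB hP, uniform_u11GFormB hP⟩,
    fun _ => ⟨uniform_u11PFormB hP, uniform_u11PFormB hP, uniform_u11PFormB hP⟩⟩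

/-- A uniform family beats `5/2` once `k·q > M` for a certified lower bound `q ≤ (s³)^{5/6}` (`q⁶ ≤ (s³)⁵`). -/
theorem uniform_beats {M s k : ℕ} {q : ℝ} (hq : 0 ≤ q) (hq6 : q ^ 6 ≤ ((s * s * s : ℕ) : ℝ) ^ 5)
    (hM : (M : ℝ) < k * q) : Beats (5 / 2) M (cu s k) (cu s k) (cu s k) := by
  unfold Beats
  have hexp : ((5 : ℝ) / 2 / 3) = (5 : ℝ) / 6 := by norm_num
  simp only [shapeVol_cu, sum_const, card_univ, Fintype.card_fin, nsmul_eq_mul, hexp]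
  have hq' : q ≤ ((s * s * s : ℕ) : ℝ) ^ ((5 : ℝ) / 6) := le_rpow_five_sixths (by positivity) hq hq6
  have hk0 : (0 : ℝ) ≤ (k : ℝ) := by positivity
  nlinarith [hq', hk0, hM]

/-- **Method ceiling, general form.** Any order `M` admitting a uniform triple `(s, k, q)` with `k ≥ 2`, `s³ + ks² ≤ M`, `3ks² ≤ M`,
`q⁶ ≤ (s³)⁵` and `k·q > M` carries a vP-admissible shape list beating `5/2`; the census statement of crux shape is false at `M`. -/
theorem uniform_alive {M s k : ℕ} {q : ℝ} (hs : 1 ≤ s) (hk : 2 ≤ k) (hV : s ^ 3 + k * s ^ 2 ≤ M) (hP : 3 * k * s ^ 2 ≤ M)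
    (hq : 0 ≤ q) (hq6 : q ^ 6 ≤ ((s * s * s : ℕ) : ℝ) ^ 5) (hM : (M : ℝ) < k * q) :
    ∃ (N : ℕ) (a b c : Fin N → ℕ), 2 ≤ N ∧ SieveAdmissibleVP M a b c ∧ Beats (5 / 2) M a b c :=
  ⟨k, cu s k, cu s k, cu s k, hk, uniform_sieveAdmissibleVP hs hV hP, uniform_beats hq hq6 hM⟩

/-- Under the hypotheses of `uniform_alive`, the census statement of crux shape (no vP-admissible list of order `≤ M` beats `5/2`) is false at `M`. -/
theorem uniform_census_false {M s k : ℕ} {q : ℝ} (hs : 1 ≤ s) (hk : 2 ≤ k) (hV : s ^ 3 + k * s ^ 2 ≤ M) (hP : 3 * k * s ^ 2 ≤ M)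
    (hq : 0 ≤ q) (hq6 : q ^ 6 ≤ ((s * s * s : ℕ) : ℝ) ^ 5) (hM : (M : ℝ) < k * q) :
    ¬ (∀ (N M' : ℕ) (a b c : Fin N → ℕ), 2 ≤ N → M' ≤ M → SieveAdmissibleVP M' a b c → ¬ Beats (5 / 2) M' a b c) := by
  intro h
  obtain ⟨N, a, b, c, hN, hadm, hb⟩ := uniform_alive hs hk hV hP hq hq6 hM
  exact h N M a b c hN le_rfl hadm hb

/-- Example below W2's composite frontier data: `M = 1500`, `(s,k) = (10,5)`, `q = 316` (`316⁶ ≤ 1000⁵`, `5·316 = 1580 > 1500`). -/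
theorem census_false_at_1500 :
    ¬ (∀ (N M' : ℕ) (a b c : Fin N → ℕ), 2 ≤ N → M' ≤ 1500 → SieveAdmissibleVP M' a b c → ¬ Beats (5 / 2) M' a b c) :=
  uniform_census_false (s := 10) (k := 5) (q := 316) (by norm_num) (by norm_num) (by norm_num) (by norm_num) (by norm_num)
    (by norm_num) (by norm_num)

end AbelianSTPPCensusVP

end Summit.MatrixMultiplication.MatrixMultiplication.Theorems
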